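import Mathlib.InformationTheory.KullbackLeibler.Basic
import Literature.MathematicalPhysics.KineticTheory.InfiniteChainGibbsStationarityPinned
import Literature.MathematicalPhysics.KineticTheory.InfiniteChainGibbsExistenceShift
import Literature.MathematicalPhysics.KineticTheory.InfiniteChainPartialMomentumReversal
import Literature.MathematicalPhysics.KineticTheory.InfiniteChainCurrentMoments
import HarnessLib

/-!
# `LiouvilleForHeat`: the hypothesis class is inhabited by the thermal states (non-vacuity)

Support file (`--supports stmt-AtomisticToContinuum-13980`, route `ParityLiouvilleSeed`, decl
`Summit.AtomisticToContinuum.FouriersLaw.Theses.ParityLiouvilleSeed.LiouvilleForHeat`; equally for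
the crux `ZeroCurrentRigidity`, `stmt-AtomisticToContinuum-12073`).

`LiouvilleForHeat` quantifies over the probability measures `ν` on `(ℝ × ℝ)^ℤ` that are
(i) time invariant in the generator sense (`IsTimeInvariant`: `∫ 𝒜f dν = 0`, `𝒜f ∈ L¹`, for all
`f ∈ C₀¹`), (ii) translation bounded (all site moments bounded uniformly in the site),
(iii) uniformly regular w.r.t. a SHIFT-INVARIANT Gibbs state (`klDiv` of box marginals `≤ C(n+1)`),
(iv) with `j₀ ∈ L¹(ν)`. A universally quantified open statement is only as good as its hypothesis
class: this file proves, sorry-free, that the class is INHABITED — by the thermal states themselves —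
and that the conclusion `∫ j₀ dν = 0` holds on these members:

* `thermalState_liouvilleForHeat_hypotheses` — for `ω₂ > 0`, `lam ≥ 0`, `β > 0`, `T > 0`, the
  shift-invariant DLR Gibbs state `μ_T` of `pinnedChain ω₂ lam β γ` satisfies (i)–(iv): (i) is the new
  Literature theorem `isTimeInvariant_pinnedChain_of_isShiftInvariant` (LLL 1977 §4 remark (i),
  severed-flow invariance, differentiated along the severed orbits — `InfiniteChainGibbsStationarity`),
  (ii) is `exists_integral_abs_pow_add_le_pinnedChain_of_isShiftInvariant` (superstability of the
  transfer-operator state), (iii) holds with `μ_T` as its own reference (`klDiv_self`, `C = 0`),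
  (iv) `memLp_bondCurrentZ_pinnedChain`; and `∫ j₀ dμ_T = 0` (`j₀` is odd under the reversal of
  `p₀, p₁`, `IsChainGibbsMeasure.integral_bondCurrentZ_eq_zero`);
* `liouvilleForHeat_hypotheses_inhabited` — hence, for the item's parameters `ω₂, lam, β > 0`, the
  antecedent of `LiouvilleForHeat` is satisfiable (existence of `μ_T`,
  `exists_isChainGibbsMeasure_shiftInvariant_superstable_pinnedChain`);
* `zeroCurrentRigidity_hypotheses_inhabited` — the same for the crux `ZeroCurrentRigidity`
  (`IsShiftInvariant ∧ IsTimeInvariant ∧ IsRegular ∧ j₀ ∈ L¹`).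

Nothing here closes the item: `LiouvilleForHeat` itself is the open odd-sector rigidity problem
(SpohnLebowitz1977 §7(iii)); in the tree it is reduced to `ZeroCurrentRigidity` by
`liouvilleForHeat_of_zeroCurrentRigidity`. The hypothesis lists below are written out token for token
as in the route decls `LiouvilleForHeat` / `ZeroCurrentRigidity` (this file deliberately imports only
Literature modules, so that its cone does not depend on the route file).
-/

noncomputable section

namespace Summit.AtomisticToContinuum.FouriersLaw.Theorems.ParityLiouvilleSeed

open MeasureTheory InformationTheory
open Literature.MathematicalPhysics.KineticTheory.HeatConduction

/-- A box marginal of a probability measure is a probability measure. [folklore] -/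
theorem isProbabilityMeasure_boxMarginal (a : ℤ) (n : ℕ) (ν : Measure ChainConfig)
    [IsProbabilityMeasure ν] : IsProbabilityMeasure (boxMarginal a n ν) :=
  Measure.isProbabilityMeasure_map (boxRestrictAt_measurable a n).aemeasurable

/-- Every probability measure is uniformly regular with respect to ITSELF, with constant `0`:
`klDiv (ν|_Λ) (ν|_Λ) = 0 ≤ 0 · |Λ|`. [folklore] -/
theorem klDiv_boxMarginal_self_le (ν : Measure ChainConfig) [IsProbabilityMeasure ν] (a : ℤ) (n : ℕ) :
    klDiv (boxMarginal a n ν) (boxMarginal a n ν) ≤ (0 : ENNReal) * (n + 1) := by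
  haveI := isProbabilityMeasure_boxMarginal a n ν
  rw [klDiv_self]
  exact (zero_mul _).ge

/-- **The thermal states satisfy every hypothesis of `LiouvilleForHeat`, and its conclusion.** For
`ω₂ > 0`, `lam ≥ 0`, `β > 0`, any `γ`, `T > 0` and the shift-invariant DLR Gibbs state `μ` of
`pinnedChain ω₂ lam β γ` at temperature `T`: `μ` is a probability measure, time invariant in the
generator sense, translation bounded (all site moments bounded uniformly in the site), uniformly
regular with respect to a shift-invariant Gibbs state (itself, constant `0`), `j₀ ∈ L¹(μ)`, and
`∫ j₀ dμ = 0`. [folklore] -/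
theorem thermalState_liouvilleForHeat_hypotheses {ω₂ lam β : ℝ} (γ : ℝ) (hω : 0 < ω₂)
    (hl : 0 ≤ lam) (hβ : 0 < β) {T : ℝ} (hT : 0 < T) {μ : Measure ChainConfig}
    (hμ : (pinnedChain ω₂ lam β γ).IsChainGibbsMeasure T μ) (hS : IsShiftInvariant μ) :
    IsProbabilityMeasure μ ∧ IsTimeInvariant (pinnedChain ω₂ lam β γ) μ ∧
      (∀ m : ℕ, ∃ C : ℝ, ∀ x : ℤ,
        Integrable (fun σ : ChainConfig => |(σ x).1| ^ m + |(σ x).2| ^ m) μ ∧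
          ∫ σ, (|(σ x).1| ^ m + |(σ x).2| ^ m) ∂μ ≤ C) ∧
      (∃ (T : ℝ) (μT : Measure ChainConfig), 0 < T ∧
        (pinnedChain ω₂ lam β γ).IsChainGibbsMeasure T μT ∧ IsShiftInvariant μT ∧
          ∃ C : ENNReal, C ≠ ⊤ ∧ ∀ (a : ℤ) (n : ℕ),
            klDiv (boxMarginal a n μ) (boxMarginal a n μT) ≤ C * (n + 1)) ∧
      Integrable (fun σ => (pinnedChain ω₂ lam β γ).bondCurrentZ σ 0) μ ∧
      ∫ σ, (pinnedChain ω₂ lam β γ).bondCurrentZ σ 0 ∂μ = 0 := by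
  haveI : IsProbabilityMeasure μ := hμ.isProbabilityMeasure
  have hss : (pinnedChain ω₂ lam β γ).HasSuperstabilityEstimate μ :=
    (OscillatorChain.isShiftInvariant_and_hasSuperstabilityEstimate_of_tight_pinnedChain γ hω hl hβ.le
      hT hμ (oneSiteTight_of_isShiftInvariant hS)).2
  have hj : Integrable (fun σ => (pinnedChain ω₂ lam β γ).bondCurrentZ σ 0) μ :=
    memLp_one_iff_integrable.mp
      (OscillatorChain.memLp_bondCurrentZ_pinnedChain γ hω.le hl hβ hss 0 ENNReal.one_ne_top)
  exact ⟨inferInstance,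
    OscillatorChain.isTimeInvariant_pinnedChain_of_isShiftInvariant γ hω hl hβ.le hT hμ hS,
    hss.exists_integral_abs_pow_add_le_pinnedChain γ hω hl hβ.le,
    ⟨T, μ, hT, hμ, hS, 0, ENNReal.zero_ne_top, fun a n => klDiv_boxMarginal_self_le μ a n⟩,
    hj, hμ.integral_bondCurrentZ_eq_zero 0⟩

/-- **The antecedent of `LiouvilleForHeat` is satisfiable** (non-vacuity of the item, for its own
parameter range `ω₂, lam, β > 0`): there is a probability measure which is time invariant,
translation bounded, uniformly regular w.r.t. a shift-invariant Gibbs state and integrates `j₀` —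
the shift-invariant thermal state at `T = 1` — and on it the conclusion holds. [folklore] -/
theorem liouvilleForHeat_hypotheses_inhabited {ω₂ lam β : ℝ} (γ : ℝ) (hω : 0 < ω₂) (hl : 0 < lam)
    (hβ : 0 < β) :
    ∃ ν : Measure ChainConfig, IsProbabilityMeasure ν ∧
      IsTimeInvariant (pinnedChain ω₂ lam β γ) ν ∧
      (∀ m : ℕ, ∃ C : ℝ, ∀ x : ℤ,
        Integrable (fun σ : ChainConfig => |(σ x).1| ^ m + |(σ x).2| ^ m) ν ∧
          ∫ σ, (|(σ x).1| ^ m + |(σ x).2| ^ m) ∂ν ≤ C) ∧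
      (∃ (T : ℝ) (μT : Measure ChainConfig), 0 < T ∧
        (pinnedChain ω₂ lam β γ).IsChainGibbsMeasure T μT ∧ IsShiftInvariant μT ∧
          ∃ C : ENNReal, C ≠ ⊤ ∧ ∀ (a : ℤ) (n : ℕ),
            klDiv (boxMarginal a n ν) (boxMarginal a n μT) ≤ C * (n + 1)) ∧
      Integrable (fun σ => (pinnedChain ω₂ lam β γ).bondCurrentZ σ 0) ν ∧
      ∫ σ, (pinnedChain ω₂ lam β γ).bondCurrentZ σ 0 ∂ν = 0 := by
  obtain ⟨μ, hμ, hS, -⟩ :=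
    OscillatorChain.exists_isChainGibbsMeasure_shiftInvariant_superstable_pinnedChain γ hω hl.le hβ.le
      one_pos
  exact ⟨μ, thermalState_liouvilleForHeat_hypotheses γ hω hl.le hβ one_pos hμ hS⟩

/-- **The antecedent of `ZeroCurrentRigidity` is satisfiable** as well: the shift-invariant thermal
state is shift invariant, time invariant, regular (`IsRegular`, w.r.t. itself), integrates `j₀`,
and has zero mean current. [folklore] -/
theorem zeroCurrentRigidity_hypotheses_inhabited {ω₂ lam β : ℝ} (γ : ℝ) (hω : 0 < ω₂) (hl : 0 < lam)
    (hβ : 0 < β) :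
    ∃ ν : Measure ChainConfig, IsProbabilityMeasure ν ∧ IsShiftInvariant ν ∧
      IsTimeInvariant (pinnedChain ω₂ lam β γ) ν ∧ IsRegular (pinnedChain ω₂ lam β γ) ν ∧
      Integrable (fun σ => (pinnedChain ω₂ lam β γ).bondCurrentZ σ 0) ν ∧
      ∫ σ, (pinnedChain ω₂ lam β γ).bondCurrentZ σ 0 ∂ν = 0 := by
  obtain ⟨μ, hμ, hS, -⟩ :=
    OscillatorChain.exists_isChainGibbsMeasure_shiftInvariant_superstable_pinnedChain γ hω hl.le hβ.le
      one_pos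
  obtain ⟨hprob, htime, -, ⟨T, μT, hT, hG, -, C, hC, hreg⟩, hint, hzero⟩ :=
    thermalState_liouvilleForHeat_hypotheses γ hω hl.le hβ one_pos hμ hS
  exact ⟨μ, hprob, hS, htime, ⟨T, μT, hT, hG, C, hC, hreg⟩, hint, hzero⟩

end Summit.AtomisticToContinuum.FouriersLaw.Theorems.ParityLiouvilleSeed

end
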